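import Literature.NumberTheory.Rogawski1990.LocalTransferTransport
import Literature.NumberTheory.Rogawski1990.AdelicStableConjugacyG
import HarnessLib

/-!
# (14.2.1) at the finite places for the TRANSPORTED pair `(ψ_* m′, f′ ∘ ψ⁻¹)` at EVERY element — regular or not — and its reading at a rational base
# point `γ₀ ↔ γ`
(Rogawski, *Automorphic representations of unitary groups in three variables* (1990), §14.2 (14.2.1) p. 232: «if `v ∉ S`, (14.2.1) is obviously
satisfied» — for the matrix-algebra inner form `S = ∅`, so at EVERY finite place the local transfer is transport of structure along `ψ_v : G′_v ≅ G_v`)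

Topic `NumberTheory/Rogawski1990`; namespace `Literature.NumberTheory.Rogawski1990`; THEOREMS ONLY (no definition, no instance, no named fact, no
`sorry`).  Cell `pub/hodgecm-mathlib`, ENGINE T1 (crux H413), row O7 «singular semisimple classes», piece K6-ζ2 of `SPEC-O7.v1` (b-s) st-half: the
kit's pins (D1) `mq v := (ψ_v)_* mG v` and (ix′) `T′.loc v = T.loc v ∘ (ψ_v)⁻¹` make the finite-place inner-transfer identity a TRANSPORT OF STRUCTURE
valid at every element, whereas ★ `IsLocalInnerTransfer` (and hence ★ G3 `localStableOrbitalIntegral_base_eq_of_isLocalInnerTransfer`) only states it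
at REGULAR elements.  So the singular-class inner-transfer identity needs no local harmonic analysis at the finite places (only at `∞`, printed).

* `localStableOrbitalIntegral_transport_comp_symm` — `Φ^st_v(ψ γ′, f′ ∘ ψ⁻¹; ψ_* m′) = Φ′^st_v(γ′, f′; m′)` for EVERY `γ′ ∈ U(H)(L⁺_v)` (the inner step
  of ★ `isLocalInnerTransfer_transport`, exposed).
* `localStableOrbitalIntegral_eq_of_isStablyConj` — `Φ^st_v` depends on the base point only through its local stable class.
* **`localStableOrbitalIntegral_base_eq_of_loc_eq_comp_symm`** — for `γ₀ ↔ γ` rational (ANY, ★ `Corresponds`), `ψ_v` class-preserving, `m_v = (ψ_v)_* m′_v`,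
  `f_v = f′_v ∘ ψ_v⁻¹`: `Φ′^st_v((γ₀)_v, f′_v; m′_v) = Φ^st_v(γ_v, f_v; m_v)` — ★ G3 :58 with `hreg` GONE (for the transported pair);
  **`prod_localStableOrbitalIntegral_base_eq_of_loc_eq_comp_symm`** — the finite product over any `S` (★ G3 :75 twin).

## References
* [Rogawski1990] J. D. Rogawski, *Automorphic Representations of Unitary Groups in Three Variables*, Ann. of Math. Stud. 123 (1990), §14.2 (14.2.1)
  p. 232; §14.5 p. 239.
-/

set_option autoImplicit false

noncomputable section

open NumberField IsDedekindDomain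
open scoped MatrixGroups

namespace Literature.NumberTheory.Rogawski1990

open Literature.NumberTheory.Automorphic

section Congr

variable (L : Type) [Field L] [NumberField L] [IsCMField L] (H' : Matrix (Fin 3) (Fin 3) L)
  (v : HeightOneSpectrum (𝓞 ↥(maximalRealSubfield L)))
  [∀ γ : (UnitaryGroup.cmDatum L 3 H').Local v,
    MeasurableSpace ((UnitaryGroup.cmDatum L 3 H').Local v ⧸ Subgroup.centralizer ({γ} : Set ((UnitaryGroup.cmDatum L 3 H').Local v)))]

/-- **`Φ^st_v` depends on the base point only through its local stable class**: `γ₁ ∼_st γ₂ ⇒ Φ^st_v(γ₁, f; m) = Φ^st_v(γ₂, f; m)` (★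
`stableOrbitalIntegralRel_congr`; any `H′`, any element). [cite: Rogawski1990, §4.1 (4.1.1) p. 40] -/
theorem localStableOrbitalIntegral_eq_of_isStablyConj (m : OrbitalMeasureFamily ((UnitaryGroup.cmDatum L 3 H').Local v))
    (f : (UnitaryGroup.cmDatum L 3 H').Local v → ℂ) {γ₁ γ₂ : (UnitaryGroup.cmDatum L 3 H').Local v}
    (h : IsStablyConj (UnitaryGroup.conjLocal L (IsCMField.complexConj L) v) ((UnitaryGroup.adelicForm L 3 H').map (UnitaryGroup.adeleToLocal L v)) γ₁ γ₂) :
    localStableOrbitalIntegral L 3 H' v m f γ₁ = localStableOrbitalIntegral L 3 H' v m f γ₂ :=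
  stableOrbitalIntegralRel_congr (G := (UnitaryGroup.cmDatum L 3 H').Local v) (fun _ => ⟨fun h1 => h.symm.trans h1, fun h2 => h.trans h2⟩) m f

end Congr

section CM

variable (L : Type) [Field L] [NumberField L] [IsCMField L] (H' : Matrix (Fin 3) (Fin 3) L)
  (v : HeightOneSpectrum (𝓞 ↥(maximalRealSubfield L)))
  [∀ γ : (UnitaryGroup.cmDatum L 3 H').Local v,
    MeasurableSpace ((UnitaryGroup.cmDatum L 3 H').Local v ⧸ Subgroup.centralizer ({γ} : Set ((UnitaryGroup.cmDatum L 3 H').Local v)))]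
  [∀ γ : (UnitaryGroup.cmDatum L 3 H').Local v,
    BorelSpace ((UnitaryGroup.cmDatum L 3 H').Local v ⧸ Subgroup.centralizer ({γ} : Set ((UnitaryGroup.cmDatum L 3 H').Local v)))]
  [∀ γ : (UnitaryGroup.cmDatum L 3 (Matrix.of fun i j : Fin 3 => if i.val + j.val + 1 = 3 then (1 : L) else 0)).Local v,
    MeasurableSpace ((UnitaryGroup.cmDatum L 3 (Matrix.of fun i j : Fin 3 => if i.val + j.val + 1 = 3 then (1 : L) else 0)).Local v ⧸
      Subgroup.centralizer ({γ} : Set ((UnitaryGroup.cmDatum L 3 (Matrix.of fun i j : Fin 3 => if i.val + j.val + 1 = 3 then (1 : L) else 0)).Local v)))]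
  [∀ γ : (UnitaryGroup.cmDatum L 3 (Matrix.of fun i j : Fin 3 => if i.val + j.val + 1 = 3 then (1 : L) else 0)).Local v,
    BorelSpace ((UnitaryGroup.cmDatum L 3 (Matrix.of fun i j : Fin 3 => if i.val + j.val + 1 = 3 then (1 : L) else 0)).Local v ⧸
      Subgroup.centralizer ({γ} : Set ((UnitaryGroup.cmDatum L 3 (Matrix.of fun i j : Fin 3 => if i.val + j.val + 1 = 3 then (1 : L) else 0)).Local v)))]

/-- **`Φ^st_v(ψ γ′, f′ ∘ ψ⁻¹; ψ_* m′) = Φ′^st_v(γ′, f′; m′)` at EVERY `γ′`** (no regularity): transport of structure along a class-preserving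
bicontinuous `ψ_v : U(H′)(L⁺_v) ≃ₜ* U(Φ₃)(L⁺_v)` — the inner step of ★ `isLocalInnerTransfer_transport`, ★ `stableOrbitalIntegralRel_transport` with
`IsStablyConj` on both sides. [cite: Rogawski1990, §14.2 (14.2.1) p. 232] -/
theorem localStableOrbitalIntegral_transport_comp_symm
    (ψ : (UnitaryGroup.cmDatum L 3 H').Local v ≃ₜ*
      (UnitaryGroup.cmDatum L 3 (Matrix.of fun i j : Fin 3 => if i.val + j.val + 1 = 3 then (1 : L) else 0)).Local v)
    (hcl : ∀ γ', Corresponds (UnitaryGroup.conjLocal L (IsCMField.complexConj L) v)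
      ((UnitaryGroup.adelicForm L 3 H').map (UnitaryGroup.adeleToLocal L v))
      ((UnitaryGroup.adelicForm L 3 (Matrix.of fun i j : Fin 3 => if i.val + j.val + 1 = 3 then (1 : L) else 0)).map
        (UnitaryGroup.adeleToLocal L v)) γ' (ψ γ'))
    (m' : OrbitalMeasureFamily ((UnitaryGroup.cmDatum L 3 H').Local v)) (f' : (UnitaryGroup.cmDatum L 3 H').Local v → ℂ)
    (γ' : (UnitaryGroup.cmDatum L 3 H').Local v) :
    localStableOrbitalIntegral L 3 (Matrix.of fun i j : Fin 3 => if i.val + j.val + 1 = 3 then (1 : L) else 0) v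
        (m'.transport ψ.toMulEquiv ψ.continuous ψ.symm.continuous) (f' ∘ ψ.symm) (ψ γ') =
      localStableOrbitalIntegral L 3 H' v m' f' γ' := by
  have h := stableOrbitalIntegralRel_transport
    (A := (UnitaryGroup.cmDatum L 3 (Matrix.of fun i j : Fin 3 => if i.val + j.val + 1 = 3 then (1 : L) else 0)).Local v)
    (B := (UnitaryGroup.cmDatum L 3 H').Local v) ψ.toMulEquiv ψ.continuous ψ.symm.continuous
    (IsStablyConj (UnitaryGroup.conjLocal L (IsCMField.complexConj L) v)
      ((UnitaryGroup.adelicForm L 3 (Matrix.of fun i j : Fin 3 => if i.val + j.val + 1 = 3 then (1 : L) else 0)).map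
        (UnitaryGroup.adeleToLocal L v)))
    (IsStablyConj (UnitaryGroup.conjLocal L (IsCMField.complexConj L) v)
      ((UnitaryGroup.adelicForm L 3 H').map (UnitaryGroup.adeleToLocal L v)))
    (fun b b' => ⟨fun hb => ((hcl b).symm.trans hb).trans (hcl b'), fun hb => ((hcl b).trans hb).trans (hcl b').symm⟩)
    (fun _ y y' hc => by
      have hGL : IsConj y.val y'.val :=
        (UnitaryGroup.«local» L (IsCMField.complexConj L) 3
          (Matrix.of fun i j : Fin 3 => if i.val + j.val + 1 = 3 then (1 : L) else 0) v).subtype.map_isConj hc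
      exact ⟨fun h' => h'.trans hGL, fun h' => h'.trans hGL.symm⟩)
    (fun _ y y' hc => by
      have hGL : IsConj y.val y'.val := (UnitaryGroup.«local» L (IsCMField.complexConj L) 3 H' v).subtype.map_isConj hc
      exact ⟨fun h' => h'.trans hGL, fun h' => h'.trans hGL.symm⟩)
    m' (f' ∘ ψ.symm) γ'
  have hcomp : ((f' ∘ ψ.symm) ∘ (ψ.toMulEquiv : (UnitaryGroup.cmDatum L 3 H').Local v →
      (UnitaryGroup.cmDatum L 3 (Matrix.of fun i j : Fin 3 => if i.val + j.val + 1 = 3 then (1 : L) else 0)).Local v)) = f' :=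
    funext fun b => by
      show f' (ψ.symm (ψ b)) = f' b
      rw [ContinuousMulEquiv.symm_apply_apply]
  rw [hcomp] at h
  exact h

end CM

/-! ## The base-point reading for a rational correspondent `γ₀ ↔ γ` (no regularity) -/

section BasePoint

variable {L : Type} [Field L] [NumberField L] [IsCMField L] {H : Matrix (Fin 3) (Fin 3) L}
  {γ₀ : (UnitaryGroup.cmDatum L 3 H).Rational}
  {γ : (UnitaryGroup.cmDatum L 3 (Matrix.of fun i j : Fin 3 => if i.val + j.val + 1 = 3 then (1 : L) else 0)).Rational}
  [∀ (v : HeightOneSpectrum (𝓞 ↥(maximalRealSubfield L))) (x : (UnitaryGroup.cmDatum L 3 H).Local v),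
    MeasurableSpace ((UnitaryGroup.cmDatum L 3 H).Local v ⧸ Subgroup.centralizer ({x} : Set ((UnitaryGroup.cmDatum L 3 H).Local v)))]
  [∀ (v : HeightOneSpectrum (𝓞 ↥(maximalRealSubfield L))) (x : (UnitaryGroup.cmDatum L 3 H).Local v),
    BorelSpace ((UnitaryGroup.cmDatum L 3 H).Local v ⧸ Subgroup.centralizer ({x} : Set ((UnitaryGroup.cmDatum L 3 H).Local v)))]
  [∀ (v : HeightOneSpectrum (𝓞 ↥(maximalRealSubfield L)))
    (x : (UnitaryGroup.cmDatum L 3 (Matrix.of fun i j : Fin 3 => if i.val + j.val + 1 = 3 then (1 : L) else 0)).Local v),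
    MeasurableSpace ((UnitaryGroup.cmDatum L 3 (Matrix.of fun i j : Fin 3 => if i.val + j.val + 1 = 3 then (1 : L) else 0)).Local v ⧸
      Subgroup.centralizer ({x} : Set ((UnitaryGroup.cmDatum L 3 (Matrix.of fun i j : Fin 3 => if i.val + j.val + 1 = 3 then (1 : L) else 0)).Local v)))]
  [∀ (v : HeightOneSpectrum (𝓞 ↥(maximalRealSubfield L)))
    (x : (UnitaryGroup.cmDatum L 3 (Matrix.of fun i j : Fin 3 => if i.val + j.val + 1 = 3 then (1 : L) else 0)).Local v),
    BorelSpace ((UnitaryGroup.cmDatum L 3 (Matrix.of fun i j : Fin 3 => if i.val + j.val + 1 = 3 then (1 : L) else 0)).Local v ⧸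
      Subgroup.centralizer ({x} : Set ((UnitaryGroup.cmDatum L 3 (Matrix.of fun i j : Fin 3 => if i.val + j.val + 1 = 3 then (1 : L) else 0)).Local v)))]

/-- **(14.2.1) at the finite place `v` for the TRANSPORTED pair, read at ANY rational base point**: `ψ_v` class-preserving, `m_v = (ψ_v)_* m′_v`,
`f_v = f′_v ∘ ψ_v⁻¹`, `γ₀ ↔ γ` (★ `Corresponds`, regular OR singular): `Φ′^st_v((γ₀)_v, f′_v; m′_v) = Φ^st_v(γ_v, f_v; m_v)` — ★ G3
`localStableOrbitalIntegral_base_eq_of_isLocalInnerTransfer` without `hreg` (transport at `(γ₀)_v`, then `ψ_v (γ₀)_v ∼_st γ_v` by ★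
`corresponds_toLocal_toAdelic` + ★ `Corresponds.isStablyConj_right`). [cite: Rogawski1990, §14.2 (14.2.1) p. 232; §14.5 p. 239] -/
theorem localStableOrbitalIntegral_base_eq_of_loc_eq_comp_symm (v : HeightOneSpectrum (𝓞 ↥(maximalRealSubfield L)))
    (ψ : (UnitaryGroup.cmDatum L 3 H).Local v ≃ₜ*
      (UnitaryGroup.cmDatum L 3 (Matrix.of fun i j : Fin 3 => if i.val + j.val + 1 = 3 then (1 : L) else 0)).Local v)
    (hcl : ∀ γ', Corresponds (UnitaryGroup.conjLocal L (IsCMField.complexConj L) v)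
      ((UnitaryGroup.adelicForm L 3 H).map (UnitaryGroup.adeleToLocal L v))
      ((UnitaryGroup.adelicForm L 3 (Matrix.of fun i j : Fin 3 => if i.val + j.val + 1 = 3 then (1 : L) else 0)).map
        (UnitaryGroup.adeleToLocal L v)) γ' (ψ γ'))
    (m' : OrbitalMeasureFamily ((UnitaryGroup.cmDatum L 3 H).Local v)) {f' : (UnitaryGroup.cmDatum L 3 H).Local v → ℂ}
    {f : (UnitaryGroup.cmDatum L 3 (Matrix.of fun i j : Fin 3 => if i.val + j.val + 1 = 3 then (1 : L) else 0)).Local v → ℂ}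
    (hf : f = f' ∘ ψ.symm)
    (hγ : Corresponds (cmConjRingHom L) H (Matrix.of fun i j : Fin 3 => if i.val + j.val + 1 = 3 then (1 : L) else 0) γ₀ γ) :
    localStableOrbitalIntegral L 3 H v m' f' ((UnitaryGroup.cmDatum L 3 H).toLocal v ((UnitaryGroup.cmDatum L 3 H).toAdelic γ₀)) =
      localStableOrbitalIntegral L 3 (Matrix.of fun i j : Fin 3 => if i.val + j.val + 1 = 3 then (1 : L) else 0) v
        (m'.transport ψ.toMulEquiv ψ.continuous ψ.symm.continuous) f
        ((UnitaryGroup.cmDatum L 3 (Matrix.of fun i j : Fin 3 => if i.val + j.val + 1 = 3 then (1 : L) else 0)).toLocal v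
          ((UnitaryGroup.cmDatum L 3 (Matrix.of fun i j : Fin 3 => if i.val + j.val + 1 = 3 then (1 : L) else 0)).toAdelic γ)) := by
  rw [hf, ← localStableOrbitalIntegral_transport_comp_symm L H v ψ hcl m' f']
  -- `ψ (γ₀)_v ∼_st γ_v`: both correspond to `(γ₀)_v`
  exact localStableOrbitalIntegral_eq_of_isStablyConj L _ v _ _ ((hcl _).isStablyConj_right (corresponds_toLocal_toAdelic hγ v))

/-- **The finite product over any finite set of places `S`** (★ G3 :75 twin without `hreg`, for the transported pairs at every `v`).
[cite: Rogawski1990, §14.2 (14.2.1) p. 232] -/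
theorem prod_localStableOrbitalIntegral_base_eq_of_loc_eq_comp_symm
    (ψ : ∀ v : HeightOneSpectrum (𝓞 ↥(maximalRealSubfield L)), (UnitaryGroup.cmDatum L 3 H).Local v ≃ₜ*
      (UnitaryGroup.cmDatum L 3 (Matrix.of fun i j : Fin 3 => if i.val + j.val + 1 = 3 then (1 : L) else 0)).Local v)
    (hcl : ∀ v γ', Corresponds (UnitaryGroup.conjLocal L (IsCMField.complexConj L) v)
      ((UnitaryGroup.adelicForm L 3 H).map (UnitaryGroup.adeleToLocal L v))
      ((UnitaryGroup.adelicForm L 3 (Matrix.of fun i j : Fin 3 => if i.val + j.val + 1 = 3 then (1 : L) else 0)).map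
        (UnitaryGroup.adeleToLocal L v)) γ' (ψ v γ'))
    (m' : ∀ v : HeightOneSpectrum (𝓞 ↥(maximalRealSubfield L)), OrbitalMeasureFamily ((UnitaryGroup.cmDatum L 3 H).Local v))
    (f' : ∀ v : HeightOneSpectrum (𝓞 ↥(maximalRealSubfield L)), (UnitaryGroup.cmDatum L 3 H).Local v → ℂ)
    (f : ∀ v : HeightOneSpectrum (𝓞 ↥(maximalRealSubfield L)),
      (UnitaryGroup.cmDatum L 3 (Matrix.of fun i j : Fin 3 => if i.val + j.val + 1 = 3 then (1 : L) else 0)).Local v → ℂ)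
    (hf : ∀ v, f v = f' v ∘ (ψ v).symm)
    (hγ : Corresponds (cmConjRingHom L) H (Matrix.of fun i j : Fin 3 => if i.val + j.val + 1 = 3 then (1 : L) else 0) γ₀ γ)
    (S : Finset (HeightOneSpectrum (𝓞 ↥(maximalRealSubfield L)))) :
    ∏ v ∈ S, localStableOrbitalIntegral L 3 H v (m' v) (f' v) ((UnitaryGroup.cmDatum L 3 H).toLocal v ((UnitaryGroup.cmDatum L 3 H).toAdelic γ₀)) =
      ∏ v ∈ S, localStableOrbitalIntegral L 3 (Matrix.of fun i j : Fin 3 => if i.val + j.val + 1 = 3 then (1 : L) else 0) v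
        ((m' v).transport (ψ v).toMulEquiv (ψ v).continuous (ψ v).symm.continuous) (f v)
        ((UnitaryGroup.cmDatum L 3 (Matrix.of fun i j : Fin 3 => if i.val + j.val + 1 = 3 then (1 : L) else 0)).toLocal v
          ((UnitaryGroup.cmDatum L 3 (Matrix.of fun i j : Fin 3 => if i.val + j.val + 1 = 3 then (1 : L) else 0)).toAdelic γ)) :=
  Finset.prod_congr rfl fun v _ => localStableOrbitalIntegral_base_eq_of_loc_eq_comp_symm v (ψ v) (hcl v) (m' v) (hf v) hγ

end BasePoint

end Literature.NumberTheory.Rogawski1990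

end
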